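import Literature.Topology.FourManifolds.RegularLevelCollar
import Literature.Topology.FourManifolds.IsotopyExtensionCorners
import Literature.Topology.FourManifolds.ImmersionCriterion
import Literature.Topology.FourManifolds.ImmersionOrientation
import Literature.Topology.FourManifolds.MorseProofs
import Literature.Geometry.Manifold.RegularValuesReal
import Mathlib.Analysis.SpecialFunctions.SmoothTransition
import HarnessLib

/-!
# Straightening an embedded hypersurface to a product near a regular slab of an ambient function

Topic `Literature/Topology/FourManifolds`; brick D3-c of the constructive road (P1′) to
`Literature.Topology.FourManifolds.Trisection.isConnectedSum_of_reducing_separating`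
(`ReducibleTrisectionSplitting.lean`, § Status): before the disc-sphere `R ⊂ ∂Z` of a sector can
be filled through the `1`-handles by product discs, it has to meet a belt slab
`[a - 2η, a + 2η] × S²` of the handle in a PRODUCT `[a - 2η, a + 2η] × C`.  This file performs
that straightening for an arbitrary smooth embedding `f : Q ↪ N` of a closed manifold into a
closed manifold and an arbitrary smooth ambient function `S : N → ℝ`, near a level `a` which is
regular for `σ = S ∘ f` (which Sard's theorem provides in every interval, §1).  **Everything
here is proved; auxiliary definitions (`SlabStraightening.cut`, `.disp`, `.prof`, `.toFun`, `.G`,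
`.smoothIsotopy`), no named fact.**

Data (§2, structure-free: hypotheses of the theorems): unit-speed fields `U_Q` for `σ` on `Q`
and `U_N` for `S` on `N` across the level `a` (`Literature.Topology.FourManifolds.LevelUnitField`,
`RegularLevelCollar.lean`: flows `fl` with the clock `σ (fl u t) = σ u + t` on the band, drop
onto the level), and `η > 0` with `3η` below both band widths.  With the cut-offs
`χ = 1` on `|r| ≤ 2η`, `χ = 0` on `|r| ≥ 5η/2` and `ψ = Real.smoothTransition` in the time
variable, put `θ t u = ψ t · χ(σ u - a) · (σ u - a)` and

  `toFun t u = U_N.fl (f (U_Q.fl u (-θ t u))) (θ t u)`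

— slide `u` down its own gradient line to the level `σ = σ u - θ`, map by `f`, and slide back
up the AMBIENT gradient line by the same amount.  Then (§3) `toFun 0 = f`; `toFun t = f` off the
slab `|σ - a| < 5η/2`; `S ∘ toFun t = σ` (levels are kept); `toFun 1 u = U_N.fl (f (drop u))
(σ u - a)` on `|σ u - a| ≤ 2η`, i.e. `toFun 1` carries the slab `σ⁻¹[a - 2η, a + 2η]` onto the
PRODUCT flow-out `{U_N.fl y r | y ∈ f(σ⁻¹ a), |r| ≤ 2η}` of the image level; each stage is
injective (§3) and an immersion (§4: the `S`-clock controls the transverse direction, and along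
a level of `σ` the stage is a diffeomorphism of `Q`, then `f`, then a diffeomorphism of `N`),
hence a smooth embedding of the compact `Q`; the stages form a `SmoothIsotopy` (§5), so the
tree's isotopy extension theorem (`SmoothIsotopy.exists_ambientIsotopy_comp_eq_holds`,
`IsotopyExtensionCorners.lean`; Hirsch, Ch. 8 §1, Thm. 1.3) yields an AMBIENT isotopy `Ψ` of `N`
with `Ψ_t ∘ f = toFun t` (§5, `exists_ambientIsotopy_straighten`), and the straightened slab
piece `(Ψ₁ ∘ f) {|σ - a| ≤ 2η}` is the product `{U_N.fl (f c) r | σ c = a, |r| ≤ 2η}`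
(`image_slab_eq_product`).

Use (brick D3-d/e of the road): `N = ∂Z` the boundary `3`-manifold of a sector, `Q = 𝕊²` the
disc-sphere `R`, `S` the globalised handle coordinate of a `1`-handle (whose unit field is
`∂_s` on the belt region, so that `U_N.fl` is the handle's product structure), `a` a regular
value of `S ∘ f` in the belt range (§1).

## References
* J. Milnor, *Morse theory* (1963), Thm. 3.1 (product neighbourhood of a regular level).
  [Milnor1963]
* M. W. Hirsch, *Differential Topology*, GTM 33 (1976), Ch. 8 §1, Thm. 1.3 (isotopy extension);
  Ch. 4 §6. [HirschDT1976]
* J. Milnor, *Topology from the Differentiable Viewpoint* (1965), §3 (Sard, Brown).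
  [MilnorTDV1965]
-/

noncomputable section

open scoped Manifold ContDiff Topology
open Set Function Metric Filter

universe u

namespace Literature.Topology.FourManifolds

/-- Local notation: `𝔼 n` is the model Euclidean space `EuclideanSpace ℝ (Fin n)`. -/
local notation "𝔼 " n:arg => EuclideanSpace ℝ (Fin n)

/-! ### §1 Regular slabs exist in every interval (Sard + closedness of the critical set) -/

section RegularSlab

variable {m : ℕ} {Q : Type u} [TopologicalSpace Q] [CompactSpace Q]
  [ChartedSpace (𝔼 (m + 1)) Q] [IsManifold (𝓡 (m + 1)) ∞ Q]

/-- **The critical values of a smooth function on a closed manifold form a closed set** (image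
of the compact critical set, `isClosed_criticalSet_of_contMDiff`). [cite: Milnor1963, §2] -/
theorem isClosed_image_criticalSet {σ : Q → ℝ} (hσ : ContMDiff (𝓡 (m + 1)) 𝓘(ℝ, ℝ) ∞ σ) :
    IsClosed (σ '' criticalSet (𝓡 (m + 1)) σ) :=
  (((isClosed_criticalSet_of_contMDiff hσ (by norm_cast)).isCompact).image
    hσ.continuous).isClosed

/-- **A whole slab of regular values in every interval.**  For a smooth `σ : Q → ℝ` on a closed
manifold and `p < q` there are `a` and `η > 0` with `[a - 3η, a + 3η] ⊆ (p, q)` consisting of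
regular values of `σ`: no critical point of `σ` has its value there (Brown's corollary of Sard's
theorem, `Literature.Geometry.Manifold.exists_mem_Ioo_forall_mfderiv_ne_zero`, and closedness
of the set of critical values). [cite: MilnorTDV1965, §3, Corollary (Brown) p. 17] -/
theorem exists_slab_regularValues {σ : Q → ℝ} (hσ : ContMDiff (𝓡 (m + 1)) 𝓘(ℝ, ℝ) ∞ σ)
    {p q : ℝ} (hpq : p < q) :
    ∃ a η : ℝ, 0 < η ∧ p < a - 3 * η ∧ a + 3 * η < q ∧
      ∀ x, σ x ∈ Icc (a - 3 * η) (a + 3 * η) → ¬ IsMCriticalPt (𝓡 (m + 1)) σ x := by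
  obtain ⟨a, ha, hreg⟩ :=
    Literature.Geometry.Manifold.exists_mem_Ioo_forall_mfderiv_ne_zero hσ isCompact_univ hpq
  have haK : a ∉ σ '' criticalSet (𝓡 (m + 1)) σ := by
    rintro ⟨x, hx, rfl⟩
    exact hreg x (mem_univ x) rfl hx
  obtain ⟨ε, hε, hball⟩ := Metric.isOpen_iff.1 (isClosed_image_criticalSet hσ).isOpen_compl a haK
  set η : ℝ := min (ε / 4) (min ((a - p) / 4) ((q - a) / 4)) with hη
  have hη_pos : 0 < η := by
    simp only [hη, lt_min_iff]
    exact ⟨by linarith, by linarith [ha.1], by linarith [ha.2]⟩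
  have hηε : 3 * η < ε := by
    have : η ≤ ε / 4 := min_le_left _ _
    linarith
  have hηp : p < a - 3 * η := by
    have : η ≤ (a - p) / 4 := (min_le_right _ _).trans (min_le_left _ _)
    linarith [ha.1]
  have hηq : a + 3 * η < q := by
    have : η ≤ (q - a) / 4 := (min_le_right _ _).trans (min_le_right _ _)
    linarith [ha.2]
  refine ⟨a, η, hη_pos, hηp, hηq, fun x hx hcrit => ?_⟩
  have hmem : σ x ∈ ball a ε := by
    rw [mem_ball, Real.dist_eq, abs_lt]
    constructor <;> linarith [hx.1, hx.2]
  exact hball hmem ⟨x, hcrit, rfl⟩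

end RegularSlab

/-! ### §2 The cut-offs -/

namespace SlabStraightening

/-- The slab cut-off `χ r = ST((25η²/4 - r²)/(9η²/4))`: `= 1` for `|r| ≤ 2η`, `= 0` for
`|r| ≥ 5η/2`, values in `[0, 1]`, smooth (a polynomial inside `Real.smoothTransition`).
[folklore] -/
def cut (η r : ℝ) : ℝ := Real.smoothTransition ((25 / 4 * η ^ 2 - r ^ 2) / (9 / 4 * η ^ 2))

/-- `χ` is smooth. [folklore] -/
theorem contDiff_cut (η : ℝ) : ContDiff ℝ ∞ (cut η) := by
  unfold cut
  exact Real.smoothTransition.contDiff.comp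
    ((contDiff_const.sub (contDiff_id.pow 2)).div_const _)

/-- `χ = 1` on `|r| ≤ 2η`. [folklore] -/
theorem cut_of_abs_le {η r : ℝ} (hη : 0 < η) (hr : |r| ≤ 2 * η) : cut η r = 1 := by
  unfold cut
  apply Real.smoothTransition.one_of_one_le
  rw [le_div_iff₀ (by positivity)]
  have : r ^ 2 ≤ (2 * η) ^ 2 := by
    rw [← sq_abs r]; exact pow_le_pow_left₀ (abs_nonneg r) hr 2
  nlinarith

/-- `χ = 0` on `5η/2 ≤ |r|`. [folklore] -/
theorem cut_of_le_abs {η r : ℝ} (hη : 0 < η) (hr : 5 / 2 * η ≤ |r|) : cut η r = 0 := by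
  unfold cut
  apply Real.smoothTransition.zero_of_nonpos
  apply div_nonpos_of_nonpos_of_nonneg _ (by positivity)
  have : (5 / 2 * η) ^ 2 ≤ r ^ 2 := by
    rw [← sq_abs r]; exact pow_le_pow_left₀ (by positivity) hr 2
  nlinarith

/-- `0 ≤ χ ≤ 1`. [folklore] -/
theorem cut_mem_Icc (η r : ℝ) : cut η r ∈ Icc (0 : ℝ) 1 :=
  ⟨Real.smoothTransition.nonneg _, Real.smoothTransition.le_one _⟩

/-- The time cut-off `ψ = Real.smoothTransition`: `ψ 0 = 0`, `ψ 1 = 1`, values in `[0, 1]`.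
[folklore] -/
abbrev timeCut (t : ℝ) : ℝ := Real.smoothTransition t

/-- `ψ 0 = 0`. [folklore] -/
theorem timeCut_zero : timeCut 0 = 0 := Real.smoothTransition.zero_of_nonpos le_rfl

/-- `ψ 1 = 1`. [folklore] -/
theorem timeCut_one : timeCut 1 = 1 := Real.smoothTransition.one_of_one_le le_rfl

end SlabStraightening

/-! ### §3 The straightening family and its elementary properties -/

namespace SlabStraightening

section Disp

variable {Q N : Type u} {f : Q → N} {S : N → ℝ} {a η : ℝ}

/-- The displacement `θ t u = ψ t · χ(σ u - a) · (σ u - a)`, `σ = S ∘ f`. [folklore] -/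
def disp (f : Q → N) (S : N → ℝ) (a η t : ℝ) (u : Q) : ℝ :=
  timeCut t * cut η (S (f u) - a) * (S (f u) - a)

/-- `θ = c · (σ u - a)` with `c ∈ [0, 1]`. [folklore] -/
theorem disp_eq_mul (t : ℝ) (u : Q) :
    ∃ c ∈ Icc (0 : ℝ) 1, disp f S a η t u = c * (S (f u) - a) := by
  refine ⟨timeCut t * cut η (S (f u) - a), ⟨mul_nonneg (Real.smoothTransition.nonneg _)
    (cut_mem_Icc _ _).1, ?_⟩, rfl⟩
  calc timeCut t * cut η (S (f u) - a) ≤ 1 * 1 := by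
        gcongr
        · exact (cut_mem_Icc _ _).1
        · exact Real.smoothTransition.le_one _
        · exact (cut_mem_Icc _ _).2
    _ = 1 := by ring

/-- `|θ| ≤ |σ u - a|`. [folklore] -/
theorem abs_disp_le (t : ℝ) (u : Q) : |disp f S a η t u| ≤ |S (f u) - a| := by
  obtain ⟨c, hc, h⟩ := disp_eq_mul (f := f) (S := S) (a := a) (η := η) t u
  rw [h, abs_mul, abs_of_nonneg hc.1]
  calc c * |S (f u) - a| ≤ 1 * |S (f u) - a| := by gcongr; exact hc.2
    _ = |S (f u) - a| := one_mul _

/-- `|(σ u - a) - θ| ≤ |σ u - a|` (the displacement never overshoots the level). [folklore] -/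
theorem abs_sub_disp_le (t : ℝ) (u : Q) : |S (f u) - a - disp f S a η t u| ≤ |S (f u) - a| := by
  obtain ⟨c, hc, h⟩ := disp_eq_mul (f := f) (S := S) (a := a) (η := η) t u
  rw [h, show S (f u) - a - c * (S (f u) - a) = (1 - c) * (S (f u) - a) by ring, abs_mul,
    abs_of_nonneg (by linarith [hc.2])]
  calc (1 - c) * |S (f u) - a| ≤ 1 * |S (f u) - a| := by gcongr; linarith [hc.1]
    _ = |S (f u) - a| := one_mul _

/-- `θ = 0` off the slab `|σ - a| < 5η/2`. [folklore] -/
theorem disp_of_le_abs (hη : 0 < η) (t : ℝ) {u : Q} (hu : 5 / 2 * η ≤ |S (f u) - a|) :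
    disp f S a η t u = 0 := by
  unfold disp; rw [cut_of_le_abs hη hu]; ring

/-- `θ 0 u = 0`. [folklore] -/
theorem disp_zero (u : Q) : disp f S a η 0 u = 0 := by
  unfold disp; rw [timeCut_zero]; ring

/-- `θ 1 u = σ u - a` on `|σ u - a| ≤ 2η`. [folklore] -/
theorem disp_one (hη : 0 < η) {u : Q} (hu : |S (f u) - a| ≤ 2 * η) :
    disp f S a η 1 u = S (f u) - a := by
  unfold disp; rw [timeCut_one, cut_of_abs_le hη hu]; ring

/-- The scalar profile `g t r = ψ t · χ (r - a) · (r - a)`, so that `θ t = g t ∘ σ`. [folklore] -/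
def prof (a η t r : ℝ) : ℝ := timeCut t * cut η (r - a) * (r - a)

/-- `θ t = g t ∘ σ`. [folklore] -/
theorem disp_eq_prof_comp (t : ℝ) : disp f S a η t = prof a η t ∘ (S ∘ f) := rfl

/-- The profile is smooth jointly in `(t, r)`. [folklore] -/
theorem contDiff_uncurry_prof : ContDiff ℝ ∞ (uncurry (prof a η)) := by
  have h1 : ContDiff ℝ ∞ fun p : ℝ × ℝ => timeCut p.1 :=
    Real.smoothTransition.contDiff.comp contDiff_fst
  have h2 : ContDiff ℝ ∞ fun p : ℝ × ℝ => cut η (p.2 - a) :=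
    (contDiff_cut η).comp (contDiff_snd.sub contDiff_const)
  exact (h1.mul h2).mul (contDiff_snd.sub contDiff_const)

/-- Each profile `prof a η t` is smooth. [folklore] -/
theorem contDiff_prof (t : ℝ) : ContDiff ℝ ∞ (prof a η t) :=
  contDiff_uncurry_prof.comp (contDiff_prodMk_right t)

end Disp

section Straighten

variable {m n : ℕ} {Q : Type u} [TopologicalSpace Q] [T2Space Q] [CompactSpace Q]
  [ChartedSpace (𝔼 (m + 1)) Q] [IsManifold (𝓡 (m + 1)) ∞ Q]
  {N : Type u} [TopologicalSpace N] [T2Space N] [CompactSpace N]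
  [ChartedSpace (𝔼 (n + 1)) N] [IsManifold (𝓡 (n + 1)) ∞ N]
  {f : Q → N} {S : N → ℝ} {a : ℝ}

/-- **The straightening family** `toFun t u = U_N.fl (f (U_Q.fl u (-θ))) θ`, `θ = disp t u`.
[folklore] -/
def toFun (U_Q : LevelUnitField m (S ∘ f) a) (U_N : LevelUnitField n S a) (η t : ℝ) (u : Q) : N :=
  U_N.fl (f (U_Q.fl u (-disp f S a η t u))) (disp f S a η t u)

variable (U_Q : LevelUnitField m (S ∘ f) a) (U_N : LevelUnitField n S a) {η : ℝ}

/-- **The isotopy starts at `f`**: `toFun 0 = f`. [folklore] -/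
theorem toFun_zero : toFun U_Q U_N η 0 = f := by
  funext u
  simp [toFun, disp_zero]

/-- **`toFun t = f` off the slab** `|σ - a| < 5η/2`. [folklore] -/
theorem toFun_of_le_abs (hη : 0 < η) (t : ℝ) {u : Q} (hu : 5 / 2 * η ≤ |S (f u) - a|) :
    toFun U_Q U_N η t u = f u := by
  simp [toFun, disp_of_le_abs hη t hu]

/-- **`toFun 1` is the product map on the slab**: `toFun 1 u = U_N.fl (f (U_Q.drop u)) (σ u - a)`
for `|σ u - a| ≤ 2η`. [folklore] -/
theorem toFun_one (hη : 0 < η) {u : Q} (hu : |S (f u) - a| ≤ 2 * η) :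
    toFun U_Q U_N η 1 u = U_N.fl (f (U_Q.drop u)) (S (f u) - a) := by
  simp only [toFun, disp_one hη hu, LevelUnitField.drop, Function.comp_apply, neg_sub]

variable (hηQ : 3 * η < U_Q.δ) (hηN : 3 * η < U_N.δ)
include hηQ in
omit [TopologicalSpace N] [T2Space N] [CompactSpace N] in
/-- **The clock on `Q`**: `σ (U_Q.fl u (-θ)) = σ u - θ` on the slab `|σ u - a| < 3η`.
[cite: Milnor1963, proof of Thm. 3.1] -/
theorem apply_fl_neg_disp {u : Q} (hu : |S (f u) - a| < 3 * η) (t : ℝ) :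
    S (f (U_Q.fl u (-disp f S a η t u))) = S (f u) - disp f S a η t u := by
  have hu' := abs_lt.1 (hu.trans hηQ)
  have hband : (S ∘ f) u ∈ Ioo (a - U_Q.δ) (a + U_Q.δ) := by
    simp only [Function.comp_apply, mem_Ioo]; constructor <;> linarith [hu'.1, hu'.2]
  have hθ := abs_lt.1 ((abs_sub_disp_le (f := f) (S := S) (a := a) (η := η) t u).trans_lt
    (hu.trans hηQ))
  have hband' : (S ∘ f) u + -disp f S a η t u ∈ Ioo (a - U_Q.δ) (a + U_Q.δ) := by
    simp only [Function.comp_apply, mem_Ioo]; constructor <;> linarith [hθ.1, hθ.2]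
  have h := U_Q.apply_fl_eq_add hband hband'
  simp only [Function.comp_apply] at h
  rw [h]; ring

include hηQ hηN in
/-- **Levels are kept**: `S (toFun t u) = σ u` for every `t` and `u`. [folklore] -/
theorem apply_toFun (hη : 0 < η) (t : ℝ) (u : Q) : S (toFun U_Q U_N η t u) = S (f u) := by
  rcases lt_or_ge |S (f u) - a| (3 * η) with hu | hu
  · have h1 := apply_fl_neg_disp U_Q hηQ hu t
    have hθ := abs_lt.1 ((abs_sub_disp_le (f := f) (S := S) (a := a) (η := η) t u).trans_lt
      (hu.trans hηN))
    have hu' := abs_lt.1 (hu.trans hηN)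
    have hy : S (f (U_Q.fl u (-disp f S a η t u))) ∈ Ioo (a - U_N.δ) (a + U_N.δ) := by
      rw [h1, mem_Ioo]; constructor <;> linarith [hθ.1, hθ.2]
    have hy' : S (f (U_Q.fl u (-disp f S a η t u))) + disp f S a η t u ∈
        Ioo (a - U_N.δ) (a + U_N.δ) := by
      rw [h1, mem_Ioo]; constructor <;> linarith [hu'.1, hu'.2]
    unfold toFun
    rw [U_N.apply_fl_eq_add hy hy', h1]; ring
  · rw [toFun_of_le_abs U_Q U_N hη t (by linarith)]

include hηQ hηN in
/-- **Each stage is injective.** If `toFun t u = toFun t u'` then `σ u = σ u'` (apply `S`), so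
the displacements agree, and peeling off the two flows and `f` gives `u = u'`. [folklore] -/
theorem injective_toFun (hη : 0 < η) (hf : Injective f) (t : ℝ) :
    Injective (toFun U_Q U_N η t) := by
  intro u u' h
  have hσ : S (f u) = S (f u') := by
    rw [← apply_toFun U_Q U_N hηQ hηN hη t u, ← apply_toFun U_Q U_N hηQ hηN hη t u', h]
  have hθ : disp f S a η t u = disp f S a η t u' := by unfold disp; rw [hσ]
  unfold toFun at h
  rw [hθ] at h
  have h2 : f (U_Q.fl u (-disp f S a η t u')) = f (U_Q.fl u' (-disp f S a η t u')) := by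
    have := congrArg (fun y => U_N.fl y (-disp f S a η t u')) h
    simpa only [U_N.fl_neg_fl] using this
  have h3 := hf h2
  have := congrArg (fun x => U_Q.fl x (disp f S a η t u')) h3
  simpa only [← U_Q.fl_add, neg_add_cancel, U_Q.fl_zero] using this

/-! ### §4 Smoothness, and each stage is an immersion -/

/-- The two-variable map `G (x, s) = U_N.fl (f (U_Q.fl x (-s))) s` behind the family:
`toFun t u = G (u, θ t u)`. [folklore] -/
def G (p : Q × ℝ) : N := U_N.fl (f (U_Q.fl p.1 (-p.2))) p.2

/-- `toFun t = G ∘ (id, θ t)`. [folklore] -/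
theorem toFun_eq_G_comp (t : ℝ) :
    toFun U_Q U_N η t = G U_Q U_N ∘ fun u => (u, disp f S a η t u) := rfl

/-- `G` is smooth. [folklore] -/
theorem contMDiff_G (hf : ContMDiff (𝓡 (m + 1)) (𝓡 (n + 1)) ∞ f) :
    ContMDiff ((𝓡 (m + 1)).prod 𝓘(ℝ, ℝ)) (𝓡 (n + 1)) ∞ (G U_Q U_N) := by
  unfold G
  have h1 : ContMDiff ((𝓡 (m + 1)).prod 𝓘(ℝ, ℝ)) (𝓡 (m + 1)) ∞
      fun p : Q × ℝ => U_Q.fl p.1 (-p.2) :=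
    U_Q.contMDiff_fl.comp (contMDiff_fst.prodMk (contDiff_neg.comp_contMDiff contMDiff_snd))
  exact U_N.contMDiff_fl.comp ((hf.comp h1).prodMk contMDiff_snd)

omit [T2Space Q] [CompactSpace Q] [IsManifold (𝓡 (m + 1)) ∞ Q] [TopologicalSpace N] [T2Space N]
  [CompactSpace N] in
/-- The displacement is smooth jointly in `(t, u)`. [folklore] -/
theorem contMDiff_uncurry_disp (hσ : ContMDiff (𝓡 (m + 1)) 𝓘(ℝ, ℝ) ∞ (S ∘ f)) :
    ContMDiff (𝓘(ℝ, ℝ).prod (𝓡 (m + 1))) 𝓘(ℝ, ℝ) ∞ (uncurry fun t u => disp f S a η t u) :=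
  contDiff_uncurry_prof (a := a) (η := η) |>.comp_contMDiff
    (contMDiff_fst.prodMk_space (hσ.comp contMDiff_snd))

omit [T2Space Q] [CompactSpace Q] [IsManifold (𝓡 (m + 1)) ∞ Q] [TopologicalSpace N] [T2Space N]
  [CompactSpace N] in
/-- Each displacement `θ t` is smooth on `Q`. [folklore] -/
theorem contMDiff_disp (hσ : ContMDiff (𝓡 (m + 1)) 𝓘(ℝ, ℝ) ∞ (S ∘ f)) (t : ℝ) :
    ContMDiff (𝓡 (m + 1)) 𝓘(ℝ, ℝ) ∞ (disp f S a η t) :=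
  (contMDiff_uncurry_disp hσ).comp (contMDiff_const.prodMk contMDiff_id)

/-- **The family is smooth jointly in `(t, u)`.** [folklore] -/
theorem contMDiff_uncurry_toFun (hf : ContMDiff (𝓡 (m + 1)) (𝓡 (n + 1)) ∞ f) :
    ContMDiff (𝓘(ℝ, ℝ).prod (𝓡 (m + 1))) (𝓡 (n + 1)) ∞ (uncurry (toFun U_Q U_N η)) :=
  (contMDiff_G U_Q U_N hf).comp (contMDiff_snd.prodMk (contMDiff_uncurry_disp U_Q.contMDiff_f))

/-- Each stage is smooth. [folklore] -/
theorem contMDiff_toFun (hf : ContMDiff (𝓡 (m + 1)) (𝓡 (n + 1)) ∞ f) (t : ℝ) :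
    ContMDiff (𝓡 (m + 1)) (𝓡 (n + 1)) ∞ (toFun U_Q U_N η t) :=
  (contMDiff_uncurry_toFun U_Q U_N hf).comp (contMDiff_const.prodMk contMDiff_id)

omit [T2Space N] [CompactSpace N] in
/-- **The time-`s` map of a unit-speed flow has injective differential** (it is undone by the
time-`(-s)` map). [cite: LeeSmoothManifolds2013, Thm. 9.12] -/
theorem injective_mfderiv_fl_apply {k : ℕ} {P : Type u} [TopologicalSpace P] [T2Space P]
    [CompactSpace P] [ChartedSpace (𝔼 (k + 1)) P] [IsManifold (𝓡 (k + 1)) ∞ P] {g : P → ℝ} {b : ℝ}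
    (U : LevelUnitField k g b) (x : P) (s : ℝ) :
    Injective (mfderiv (𝓡 (k + 1)) (𝓡 (k + 1)) (fun y => U.fl y s) x) := by
  have h1 : MDifferentiableAt (𝓡 (k + 1)) (𝓡 (k + 1)) (fun y => U.fl y s) x :=
    (U.contMDiff_fl_apply s).mdifferentiableAt (by simp)
  have h2 : MDifferentiableAt (𝓡 (k + 1)) (𝓡 (k + 1)) (fun y => U.fl y (-s)) (U.fl x s) :=
    (U.contMDiff_fl_apply (-s)).mdifferentiableAt (by simp)
  have hcomp := mfderiv_comp x h2 h1
  have hid : ((fun y => U.fl y (-s)) ∘ fun y => U.fl y s) = id := funext fun y => U.fl_neg_fl y s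
  rw [hid, mfderiv_id] at hcomp
  intro v w hvw
  have := congrArg (mfderiv (𝓡 (k + 1)) (𝓡 (k + 1)) (fun y => U.fl y (-s)) (U.fl x s)) hvw
  rwa [← ContinuousLinearMap.comp_apply, ← ContinuousLinearMap.comp_apply, ← hcomp] at this

/-- **For frozen `s`, `x ↦ G (x, s)` is an immersion**: a flow map of `Q`, then the immersion
`f`, then a flow map of `N`. [folklore] -/
theorem injective_mfderiv_G_fst (hf : ContMDiff (𝓡 (m + 1)) (𝓡 (n + 1)) ∞ f)
    (hfi : ∀ x, Injective (mfderiv (𝓡 (m + 1)) (𝓡 (n + 1)) f x)) (s : ℝ) (x : Q) :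
    Injective (mfderiv (𝓡 (m + 1)) (𝓡 (n + 1)) (fun z => G U_Q U_N (z, s)) x) := by
  have h1 : MDifferentiableAt (𝓡 (m + 1)) (𝓡 (m + 1)) (fun z => U_Q.fl z (-s)) x :=
    (U_Q.contMDiff_fl_apply (-s)).mdifferentiableAt (by simp)
  have h2 : MDifferentiableAt (𝓡 (m + 1)) (𝓡 (n + 1)) f (U_Q.fl x (-s)) :=
    hf.mdifferentiableAt (by simp)
  have h3 : MDifferentiableAt (𝓡 (n + 1)) (𝓡 (n + 1)) (fun y => U_N.fl y s) (f (U_Q.fl x (-s))) :=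
    (U_N.contMDiff_fl_apply s).mdifferentiableAt (by simp)
  have hcomp1 := mfderiv_comp x h2 h1
  have hcomp2 := mfderiv_comp x h3 (h2.comp x h1)
  have : (fun z => G U_Q U_N (z, s)) = (fun y => U_N.fl y s) ∘ (f ∘ fun z => U_Q.fl z (-s)) := rfl
  rw [this, hcomp2, hcomp1]
  exact (injective_mfderiv_fl_apply U_N _ s).comp
    ((hfi _).comp (injective_mfderiv_fl_apply U_Q x (-s)))

include hηQ hηN in
/-- **Each stage `toFun t` is an immersion.**  With `toFun t u = G (u, θ u)`,
`d(toFun t) v = d₁G v + dθ(v) ∂₂G`.  If this vanishes, apply `dS`: since `S ∘ toFun t = σ`,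
`dσ v = 0`; as `θ = g ∘ σ` also `dθ v = 0`, so `d₁G v = 0` and `v = 0` because `G (·, s)` is
an immersion. [folklore] -/
theorem injective_mfderiv_toFun (hη : 0 < η) (hf : ContMDiff (𝓡 (m + 1)) (𝓡 (n + 1)) ∞ f)
    (hfi : ∀ x, Injective (mfderiv (𝓡 (m + 1)) (𝓡 (n + 1)) f x)) (t : ℝ) (u : Q) :
    Injective (mfderiv (𝓡 (m + 1)) (𝓡 (n + 1)) (toFun U_Q U_N η t) u) := by
  set θ := disp f S a η t u with hθdef
  have hGd : MDifferentiableAt ((𝓡 (m + 1)).prod 𝓘(ℝ, ℝ)) (𝓡 (n + 1)) (G U_Q U_N) (u, θ) :=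
    (contMDiff_G U_Q U_N hf).mdifferentiableAt (by simp)
  have hθd : MDifferentiableAt (𝓡 (m + 1)) 𝓘(ℝ, ℝ) (disp f S a η t) u :=
    (contMDiff_disp U_Q.contMDiff_f t).mdifferentiableAt (by simp)
  have hP : HasMFDerivAt (𝓡 (m + 1)) ((𝓡 (m + 1)).prod 𝓘(ℝ, ℝ)) (fun u => (u, disp f S a η t u)) u
      ((ContinuousLinearMap.id ℝ (TangentSpace (𝓡 (m + 1)) u)).prod
        (mfderiv (𝓡 (m + 1)) 𝓘(ℝ, ℝ) (disp f S a η t) u)) :=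
    (hasMFDerivAt_id u).prodMk hθd.hasMFDerivAt
  have hT : HasMFDerivAt (𝓡 (m + 1)) (𝓡 (n + 1)) (toFun U_Q U_N η t) u
      ((mfderiv ((𝓡 (m + 1)).prod 𝓘(ℝ, ℝ)) (𝓡 (n + 1)) (G U_Q U_N) (u, θ)).comp
        ((ContinuousLinearMap.id ℝ (TangentSpace (𝓡 (m + 1)) u)).prod
          (mfderiv (𝓡 (m + 1)) 𝓘(ℝ, ℝ) (disp f S a η t) u))) := by
    rw [toFun_eq_G_comp]
    exact HasMFDerivAt.comp u hGd.hasMFDerivAt hP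
  -- `S ∘ toFun t = σ`, so `dS ∘ d(toFun t) = dσ`
  have hSd : MDifferentiableAt (𝓡 (n + 1)) 𝓘(ℝ, ℝ) S (toFun U_Q U_N η t u) :=
    U_N.contMDiff_f.mdifferentiableAt (by simp)
  have hσeq : S ∘ toFun U_Q U_N η t = S ∘ f :=
    funext fun u => apply_toFun U_Q U_N hηQ hηN hη t u
  have hchainσ : mfderiv (𝓡 (m + 1)) 𝓘(ℝ, ℝ) (S ∘ f) u =
      (mfderiv (𝓡 (n + 1)) 𝓘(ℝ, ℝ) S (toFun U_Q U_N η t u)).comp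
        (mfderiv (𝓡 (m + 1)) (𝓡 (n + 1)) (toFun U_Q U_N η t) u) := by
    rw [← hσeq]; exact mfderiv_comp u hSd hT.mdifferentiableAt
  -- `θ = g ∘ σ`, so `dθ = dg ∘ dσ`
  have hprofd : MDifferentiableAt 𝓘(ℝ, ℝ) 𝓘(ℝ, ℝ) (prof a η t) ((S ∘ f) u) :=
    (contDiff_prof t).contMDiff.mdifferentiableAt (by simp)
  have hσd : MDifferentiableAt (𝓡 (m + 1)) 𝓘(ℝ, ℝ) (S ∘ f) u :=
    U_Q.contMDiff_f.mdifferentiableAt (by simp)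
  have hchainθ : mfderiv (𝓡 (m + 1)) 𝓘(ℝ, ℝ) (disp f S a η t) u =
      (mfderiv 𝓘(ℝ, ℝ) 𝓘(ℝ, ℝ) (prof a η t) ((S ∘ f) u)).comp
        (mfderiv (𝓡 (m + 1)) 𝓘(ℝ, ℝ) (S ∘ f) u) := by
    rw [disp_eq_prof_comp]; exact mfderiv_comp u hprofd hσd
  refine (injective_iff_map_eq_zero _).2 fun v hv => ?_
  have hσv : mfderiv (𝓡 (m + 1)) 𝓘(ℝ, ℝ) (S ∘ f) u v = 0 := by
    rw [hchainσ]
    change mfderiv (𝓡 (n + 1)) 𝓘(ℝ, ℝ) S (toFun U_Q U_N η t u)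
      (mfderiv (𝓡 (m + 1)) (𝓡 (n + 1)) (toFun U_Q U_N η t) u v) = 0
    rw [hv, map_zero]
  have hθv : mfderiv (𝓡 (m + 1)) 𝓘(ℝ, ℝ) (disp f S a η t) u v = 0 := by
    rw [hchainθ]
    change mfderiv 𝓘(ℝ, ℝ) 𝓘(ℝ, ℝ) (prof a η t) ((S ∘ f) u)
      (mfderiv (𝓡 (m + 1)) 𝓘(ℝ, ℝ) (S ∘ f) u v) = 0
    rw [hσv, map_zero]
  rw [hT.mfderiv] at hv
  have hv2 : mfderiv ((𝓡 (m + 1)).prod 𝓘(ℝ, ℝ)) (𝓡 (n + 1)) (G U_Q U_N) (u, θ)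
      (v, mfderiv (𝓡 (m + 1)) 𝓘(ℝ, ℝ) (disp f S a η t) u v) = 0 := hv
  rw [mfderiv_prod_eq_add_apply hGd] at hv2
  dsimp only at hv2
  rw [hθv, map_zero, add_zero] at hv2
  exact (injective_iff_map_eq_zero _).1 (injective_mfderiv_G_fst U_Q U_N hf hfi θ u) v hv2

/-! ### §5 The stages are embeddings; the smooth isotopy; ambient straightening -/

include hηQ hηN in
/-- **Each stage is a smooth embedding** (injective immersion of the compact `Q`,
`isSmoothEmbedding_of_injective_of_injective_mfderiv`). [cite: HirschDT1976, Ch. 1 §3 Thm. 3.1] -/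
theorem isSmoothEmbedding_toFun (hη : 0 < η)
    (hf : Manifold.IsSmoothEmbedding (𝓡 (m + 1)) (𝓡 (n + 1)) ∞ f) (t : ℝ) :
    Manifold.IsSmoothEmbedding (𝓡 (m + 1)) (𝓡 (n + 1)) ∞ (toFun U_Q U_N η t) :=
  isSmoothEmbedding_of_injective_of_injective_mfderiv (contMDiff_toFun U_Q U_N hf.contMDiff t)
    (by norm_cast) (injective_toFun U_Q U_N hηQ hηN hη hf.isEmbedding.injective t)
    (injective_mfderiv_toFun U_Q U_N hηQ hηN hη hf.contMDiff
      (fun x => injective_mfderiv_of_isImmersionAt' (hf.isImmersion.isImmersionAt x)) t)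

/-- **The straightening family is a smooth isotopy** from `f` to `toFun 1`. [folklore] -/
def smoothIsotopy (hηQ : 3 * η < U_Q.δ) (hηN : 3 * η < U_N.δ) (hη : 0 < η)
    (hf : Manifold.IsSmoothEmbedding (𝓡 (m + 1)) (𝓡 (n + 1)) ∞ f) :
    SmoothIsotopy (𝓡 (m + 1)) (𝓡 (n + 1)) f (toFun U_Q U_N η 1) where
  toFun := toFun U_Q U_N η
  contMDiff := contMDiff_uncurry_toFun U_Q U_N hf.contMDiff
  isSmoothEmbedding := isSmoothEmbedding_toFun U_Q U_N hηQ hηN hη hf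
  map_zero := toFun_zero U_Q U_N
  map_one := rfl

include hηQ hηN in
/-- **Straightening an embedded closed manifold near a regular slab, by an ambient isotopy.**
Let `f : Q ↪ N` be a smooth embedding of a closed manifold into a closed manifold, `S : N → ℝ`
smooth, `U_Q`, `U_N` unit-speed fields for `σ = S ∘ f` on `Q` and for `S` on `N` across the
level `a`, and `0 < η` with `3η < U_Q.δ`, `3η < U_N.δ`.  Then there is an ambient isotopy `Ψ`
of `N` with, for `-1/2 < t < 3/2`: `Ψ_t ∘ f = toFun t` (the straightening family); in
particular `Ψ_1 (f u) = U_N.fl (f (U_Q.drop u)) (σ u - a)` on the slab `|σ u - a| ≤ 2η`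
(**`Ψ_1 ∘ f` is the product of the image level `f (σ⁻¹ a)` with the flow interval there**),
`Ψ_t (f u) = f u` off the slab `|σ u - a| < 5η/2`, and `S (Ψ_t (f u)) = σ u` throughout
(isotopy extension, `SmoothIsotopy.exists_ambientIsotopy_comp_eq_holds`).
[cite: HirschDT1976, Ch. 8 §1, Thm. 1.3; Milnor1963, Thm. 3.1] -/
theorem exists_ambientIsotopy_straighten (hη : 0 < η)
    (hf : Manifold.IsSmoothEmbedding (𝓡 (m + 1)) (𝓡 (n + 1)) ∞ f) :
    ∃ Ψ : AmbientIsotopy (𝓡 (n + 1)) N,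
      (∀ t ∈ Ioo (-1 / 2 : ℝ) (3 / 2), ∀ u, Ψ.toFun t (f u) = toFun U_Q U_N η t u) ∧
      (∀ u, |S (f u) - a| ≤ 2 * η →
        Ψ.toFun 1 (f u) = U_N.fl (f (U_Q.drop u)) (S (f u) - a)) ∧
      (∀ t ∈ Ioo (-1 / 2 : ℝ) (3 / 2), ∀ u, 5 / 2 * η ≤ |S (f u) - a| →
        Ψ.toFun t (f u) = f u) ∧
      (∀ t ∈ Ioo (-1 / 2 : ℝ) (3 / 2), ∀ u, S (Ψ.toFun t (f u)) = S (f u)) := by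
  obtain ⟨Ψ, hΨ⟩ := (smoothIsotopy U_Q U_N hηQ hηN hη hf).exists_ambientIsotopy_comp_eq_holds
  have key : ∀ t ∈ Ioo (-1 / 2 : ℝ) (3 / 2), ∀ u, Ψ.toFun t (f u) = toFun U_Q U_N η t u := by
    intro t ht u
    have h := hΨ t ht u
    have h0 : (smoothIsotopy U_Q U_N hηQ hηN hη hf).toFun 0 u = f u :=
      congrFun (toFun_zero U_Q U_N) u
    rw [h0] at h
    exact h
  refine ⟨Ψ, key, fun u hu => ?_, fun t ht u hu => ?_, fun t ht u => ?_⟩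
  · rw [key 1 (by norm_num) u, toFun_one U_Q U_N hη hu]
  · rw [key t ht u, toFun_of_le_abs U_Q U_N hη t hu]
  · rw [key t ht u, apply_toFun U_Q U_N hηQ hηN hη t u]

include hηQ in
/-- **The straightened piece is a product.**  For the time-`1` map: a point `y` of `N` is of
the form `Ψ_1 (f u)` with `|σ u - a| ≤ 2η` iff `y = U_N.fl (f c) r` for some `c` on the level
`σ c = a` and some `|r| ≤ 2η`. [folklore] -/
theorem image_slab_eq_product (hη : 0 < η) {Φ : N → N}
    (hΦ : ∀ u, |S (f u) - a| ≤ 2 * η → Φ (f u) = U_N.fl (f (U_Q.drop u)) (S (f u) - a)) :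
    (Φ ∘ f) '' {u | |S (f u) - a| ≤ 2 * η} =
      (fun p : Q × ℝ => U_N.fl (f p.1) p.2) '' (((S ∘ f) ⁻¹' {a}) ×ˢ Icc (-(2 * η)) (2 * η)) := by
  ext y
  simp only [mem_image, mem_setOf_eq, Function.comp_apply, mem_prod, mem_preimage,
    mem_singleton_iff, mem_Icc, Prod.exists]
  constructor
  · rintro ⟨u, hu, rfl⟩
    have hband : u ∈ U_Q.band := by
      rw [LevelUnitField.mem_band_iff, mem_Ioo, Function.comp_apply]
      have := abs_le.1 hu
      constructor <;> linarith [this.1, this.2]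
    refine ⟨U_Q.drop u, S (f u) - a, ⟨U_Q.apply_drop hband, ?_, ?_⟩, (hΦ u hu).symm⟩
    · linarith [(abs_le.1 hu).1]
    · linarith [(abs_le.1 hu).2]
  · rintro ⟨c, r, ⟨hc, hr1, hr2⟩, rfl⟩
    have hr : r ∈ Ioo (-U_Q.δ) U_Q.δ := ⟨by linarith, by linarith⟩
    have hσ : (S ∘ f) (U_Q.fl c r) = a + r := U_Q.apply_fl_of_apply_eq hc hr
    simp only [Function.comp_apply] at hσ
    have habs : |S (f (U_Q.fl c r)) - a| ≤ 2 * η := by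
      rw [hσ, add_sub_cancel_left, abs_le]; exact ⟨hr1, hr2⟩
    refine ⟨U_Q.fl c r, habs, ?_⟩
    rw [hΦ _ habs, U_Q.drop_fl_of_apply_eq hc hr, hσ, add_sub_cancel_left]

end Straighten

end SlabStraightening

end Literature.Topology.FourManifolds
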